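import Summits.CriticalPhenomena.SAWScalingLimit.Theorems.SAWDefectDecoherenceBoundaryClosureRRootWedgeStation
import HarnessLib

/-!
# Developing maps: local links and stations at the flat pieces (crux `BoundaryClosureR`,
stmt-CriticalPhenomena-14004, line `pick-half-plane`, stub `stub_developingMapsCompact`)

Support file (topic: the lattice-side inputs, AT THE PINNED FLAT PIECES, of the compactness of the
normalised developing maps `h_δ = δ (H − H(s_b))/F(b δ)`, `H` a potential of `F dz`
(Duminil-Copin–Smirnov 2012, §4)).  In the frame of a pinned flat piece (`Ω ∩ ball p R` the open
half-ball above `p`, lattice pin with threshold row `mf δ`, a boundary mid-edge `bf δ` with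
`δ·mid(bf δ) → p`, the local sup law on compacts of the closed half-ball off a point `x`):

* `row_le_of_isLatticeSite`: lattice sites near the piece lie in rows `≥ mf δ`;
* `flat_link`: the equi-Lipschitz estimate `‖δ(H s' − H s)/F(b δ)‖ ≤ C(‖δ s' − δ s‖ + δ)` at the
  lattice sites near a point `z ≠ x` of the piece (the landed `pinned_link`);
* `flat_density`: lattice sites (floor sites of the threshold row) within any `θ > 0` of `z`;
* `flat_station`: the two-sided bound `δ‖H s − H s_b‖ ≤ B‖F(b δ)‖` there, one `pinned_link` away
  from an interior station;
* `normaliser_sites_close`: the normalised increment between the two normaliser sites is `O(δ)`.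
-/

noncomputable section

open scoped Topology
open Filter Set
open Literature.Probability.LatticeModels Literature.Probability.RandomPlanarGeometry
open Literature.Probability.RandomPlanarGeometry.SAW
open Summit.CriticalPhenomena.SAWScalingLimit.Theorems.PickHalfPlane.RootWedge

namespace Summit.CriticalPhenomena.SAWScalingLimit.Theorems.PickHalfPlane.DevelopingMaps

/-! ### Lattice sites at a boundary mid-edge and over a pinned flat piece -/

/-- A common vertex of the two faces of a boundary mid-edge is a lattice site of the domain.
[folklore] -/
theorem isLatticeSite_of_mem_boundary {Λ : Finset HexVertex} {bb : Sym2 HexVertex}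
    (hb : bb ∈ hexDomainBoundary Λ) {ub wb : HexVertex} (h : bb = s(ub, wb)) {sb : Site 2}
    (h1 : sb ∈ hexFaceVertices ub) (h2 : sb ∈ hexFaceVertices wb) : IsLatticeSite Λ sb := by
  obtain ⟨-, u, v, huv, hv, -⟩ := hb
  rw [h] at huv
  rcases Sym2.eq_iff.1 huv with ⟨rfl, rfl⟩ | ⟨rfl, rfl⟩
  · exact ⟨_, hv, h2⟩
  · exact ⟨_, hv, h1⟩

/-- **Rows of lattice sites over a pinned flat piece**: under the lattice pin (row threshold `M`
inside `ball p R`), a lattice site `s` of `Λ` with `‖δ s − p‖ + δ < R` lies in a row `≥ M` (it is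
a vertex of a face of `Λ` whose scaled centre is in the ball). [folklore] -/
theorem row_le_of_isLatticeSite {Λ : Finset HexVertex} {M : ℤ} {p : ℂ} {R δ : ℝ} (hδ : 0 ≤ δ)
    (hpin : ∀ v : HexVertex, (δ : ℂ) * hexCenter v ∈ Metric.ball p R → (v ∈ Λ ↔ M ≤ v.1 1))
    {s : Site 2} (hs : IsLatticeSite Λ s) (hsR : ‖(δ : ℂ) * triEmbed s - p‖ + δ < R) : M ≤ s 1 := by
  obtain ⟨f, hf, hsf⟩ := hs
  have h1 : ‖hexCenter f - triEmbed s‖ ≤ 1 := by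
    rw [norm_sub_rev]; exact norm_triEmbed_sub_hexCenter_le hsf
  have h2 : ‖(δ : ℂ) * hexCenter f - p‖ ≤ ‖(δ : ℂ) * triEmbed s - p‖ + δ :=
    norm_scaled_sub_le hδ h1 le_rfl
  have hball : (δ : ℂ) * hexCenter f ∈ Metric.ball p R := by
    rw [Metric.mem_ball, dist_eq_norm]; linarith
  exact ((hpin f hball).1 hf).trans (rows_of_mem_hexFaceVertices hsf).1

/-- **The local link near a point of a pinned flat piece.**  Frame: `Ω ∩ ball p R` is the open
half-ball above `p`, the lattice pin with threshold `mf δ`, a boundary mid-edge `bf δ` with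
`δ·mid(bf δ) → p`, faces of `Λ δ` scaled into `Ω`, and the local sup law on compacts of the closed
half-ball off a point `x`.  Then near every `z ≠ x` of the flat piece (`im z = im p`,
`‖z − p‖ < R`): for ONE `η > 0`, `C ≥ 0`, eventually, for every potential `H`,
`‖δ (H s' − H s)/F(b δ)‖ ≤ C (‖δ s' − δ s‖ + δ)` for all LATTICE sites `s, s'` within `η` of `z`
(`pinned_link`; lattice sites there lie in rows `≥ mf δ`). [cite: DuminilCopinSmirnov2012, §4 (the map H with dH = F dz)] -/
theorem flat_link {Ω : Set ℂ} {p x : ℂ} {R : ℝ} {Λ : ℝ → Finset HexVertex} {mf : ℝ → ℤ}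
    {bf e b : ℝ → Sym2 HexVertex} (hR : 0 < R)
    (hΩ : Ω ∩ Metric.ball p R = {z : ℂ | p.im < z.im} ∩ Metric.ball p R)
    (hpin : ∀ᶠ δ : ℝ in 𝓝[>] 0, ∀ v : HexVertex,
      (δ : ℂ) * hexCenter v ∈ Metric.ball p R → (v ∈ Λ δ ↔ mf δ ≤ v.1 1))
    (hbd : ∀ᶠ δ : ℝ in 𝓝[>] 0, bf δ ∈ hexDomainBoundary (Λ δ))
    (hΛΩ : ∀ᶠ δ : ℝ in 𝓝[>] 0, ∀ v ∈ Λ δ, (δ : ℂ) * hexCenter v ∈ Ω)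
    (hlim : Tendsto (fun δ : ℝ => (δ : ℂ) * hexMidpoint (bf δ)) (𝓝[>] 0) (𝓝 p))
    (hSup : ∀ K : Set ℂ, IsCompact K → K ⊆ {z : ℂ | p.im ≤ z.im} ∩ Metric.ball p R → x ∉ K →
      ∃ C : ℝ, ∀ᶠ δ : ℝ in 𝓝[>] 0, ∀ w ∈ hexDomainMidEdges (Λ δ), (δ : ℂ) * hexMidpoint w ∈ K →
        ‖hexParafermionicObservable (Λ δ) (e δ) hexCriticalFugacity (5 / 8) w‖ ≤
          C * ‖hexParafermionicObservable (Λ δ) (e δ) hexCriticalFugacity (5 / 8) (b δ)‖)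
    {z : ℂ} (hzR : ‖z - p‖ < R) (hzim : z.im = p.im) (hzx : z ≠ x) :
    ∃ η C : ℝ, 0 < η ∧ 0 ≤ C ∧ ∀ᶠ δ : ℝ in 𝓝[>] 0, ∀ H : Site 2 → ℂ, IsPotential (Λ δ) (e δ) H →
      ∀ s s' : Site 2, IsLatticeSite (Λ δ) s → IsLatticeSite (Λ δ) s' →
      ‖(δ : ℂ) * triEmbed s - z‖ ≤ η → ‖(δ : ℂ) * triEmbed s' - z‖ ≤ η →
        ‖(δ : ℂ) * (H s' - H s) / hexParafermionicObservable (Λ δ) (e δ) hexCriticalFugacity (5 / 8) (b δ)‖ ≤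
          C * (‖(δ : ℂ) * triEmbed s' - (δ : ℂ) * triEmbed s‖ + δ) := by
  have hzx' : 0 < ‖z - x‖ := norm_pos_iff.2 (sub_ne_zero.2 hzx)
  set η : ℝ := min (R - ‖z - p‖) ‖z - x‖ / 40 with hηdef
  have hmin : 0 < min (R - ‖z - p‖) ‖z - x‖ := lt_min (by linarith) hzx'
  have hη : 0 < η := by positivity
  have h40R : ‖z - p‖ + 40 * η ≤ R := by
    have := min_le_left (R - ‖z - p‖) ‖z - x‖; rw [hηdef]; linarith
  have h40x : 40 * η ≤ ‖z - x‖ := by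
    have := min_le_right (R - ‖z - p‖) ‖z - x‖; rw [hηdef]; linarith
  -- the compact at `z` and its sup-law constant
  set K₀ : Set ℂ := {w : ℂ | p.im ≤ w.im} ∩ Metric.closedBall z (20 * η) with hK₀
  have hK₀c : IsCompact K₀ :=
    (isCompact_closedBall z _).inter_left (isClosed_le continuous_const Complex.continuous_im)
  have hK₀sub : K₀ ⊆ {w : ℂ | p.im ≤ w.im} ∩ Metric.ball p R := by
    rintro w ⟨hwim, hwz⟩
    refine ⟨hwim, Metric.mem_ball.2 ?_⟩
    have h1 := Metric.mem_closedBall.1 hwz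
    rw [dist_eq_norm] at h1 ⊢
    calc ‖w - p‖ ≤ ‖w - z‖ + ‖z - p‖ := norm_sub_le_norm_sub_add_norm_sub _ _ _
      _ < R := by linarith
  have hxK₀ : x ∉ K₀ := fun hx => by
    have h := Metric.mem_closedBall.1 hx.2
    rw [dist_comm, dist_eq_norm] at h
    linarith
  obtain ⟨C, hC⟩ := hSup K₀ hK₀c hK₀sub hxK₀
  set C' : ℝ := max C 0 with hC'def
  have hC'0 : 0 ≤ C' := le_max_right _ _
  refine ⟨η, 6 * C', hη, by positivity, ?_⟩
  have hδev : ∀ᶠ δ : ℝ in 𝓝[>] 0, δ ∈ Set.Ioo 0 η := Ioo_mem_nhdsGT hη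
  filter_upwards [hpin, hC, hδev, pinned_frame hR hη hΩ hpin hbd hΛΩ hlim] with δ hpinδ hCδ ⟨hδ0, hδη⟩
    ⟨_, _, hlow, _⟩ H hH s s' hsl hs'l hs hs'
  have hzim' : z.im = p.im := hzim
  have hlow' : z.im < δ * ((mf δ : ℝ) * (Real.sqrt 3 / 2) + Real.sqrt 3 / 6) := by rw [hzim']; exact hlow
  have hpin' : ∀ v : HexVertex, (δ : ℂ) * hexCenter v ∈ Metric.ball z (R - ‖z - p‖) →
      (v ∈ Λ δ ↔ mf δ ≤ v.1 1) := by
    intro v hv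
    refine hpinδ v (Metric.mem_ball.2 ?_)
    have h1 := Metric.mem_ball.1 hv
    rw [dist_eq_norm] at h1 ⊢
    calc ‖(δ : ℂ) * hexCenter v - p‖ ≤ ‖(δ : ℂ) * hexCenter v - z‖ + ‖z - p‖ :=
          norm_sub_le_norm_sub_add_norm_sub _ _ _
      _ < R := by linarith
  have hrow : ∀ t : Site 2, IsLatticeSite (Λ δ) t → ‖(δ : ℂ) * triEmbed t - z‖ ≤ η → mf δ ≤ t 1 :=
    fun t ht htz => row_le_of_isLatticeSite hδ0.le hpin' ht (by linarith)
  exact pinned_link (K := K₀) (x := z) (z := z) (r := R - ‖z - p‖) hδ0 hδη.le hC'0 hpin' hlow'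
    (fun w hw => ⟨by rw [← hzim']; exact hw.1, Metric.closedBall_subset_closedBall (by linarith) hw.2⟩)
    (by rw [sub_self, norm_zero]; linarith)
    (fun w hw hwK => (hCδ w hw hwK).trans (mul_le_mul_of_nonneg_right (le_max_left _ _) (norm_nonneg _)))
    (hrow s hsl hs) (hrow s' hs'l hs') hs hs' hH

/-- **Density of lattice sites near a point of a pinned flat piece**: for every `θ > 0`,
eventually some lattice site of `Λ δ` (a floor site of the threshold row) scales to within `θ`
of `z`. [folklore] -/
theorem flat_density {Ω : Set ℂ} {p : ℂ} {R : ℝ} {Λ : ℝ → Finset HexVertex} {mf : ℝ → ℤ}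
    {bf : ℝ → Sym2 HexVertex} (hR : 0 < R)
    (hΩ : Ω ∩ Metric.ball p R = {z : ℂ | p.im < z.im} ∩ Metric.ball p R)
    (hpin : ∀ᶠ δ : ℝ in 𝓝[>] 0, ∀ v : HexVertex,
      (δ : ℂ) * hexCenter v ∈ Metric.ball p R → (v ∈ Λ δ ↔ mf δ ≤ v.1 1))
    (hbd : ∀ᶠ δ : ℝ in 𝓝[>] 0, bf δ ∈ hexDomainBoundary (Λ δ))
    (hΛΩ : ∀ᶠ δ : ℝ in 𝓝[>] 0, ∀ v ∈ Λ δ, (δ : ℂ) * hexCenter v ∈ Ω)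
    (hlim : Tendsto (fun δ : ℝ => (δ : ℂ) * hexMidpoint (bf δ)) (𝓝[>] 0) (𝓝 p))
    {z : ℂ} (hzR : ‖z - p‖ < R) (hzim : z.im = p.im) {θ : ℝ} (hθ : 0 < θ) :
    ∀ᶠ δ : ℝ in 𝓝[>] 0, ∃ s : Site 2, IsLatticeSite (Λ δ) s ∧ ‖(δ : ℂ) * triEmbed s - z‖ < θ := by
  set θ₀ : ℝ := min θ (R - ‖z - p‖) / 4 with hθ₀def
  have hmin : 0 < min θ (R - ‖z - p‖) := lt_min hθ (by linarith)
  have hθ₀ : 0 < θ₀ := by positivity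
  have hθ₀θ : 4 * θ₀ ≤ θ := by have := min_le_left θ (R - ‖z - p‖); rw [hθ₀def]; linarith
  have hθ₀R : ‖z - p‖ + 4 * θ₀ ≤ R := by have := min_le_right θ (R - ‖z - p‖); rw [hθ₀def]; linarith
  have hδev : ∀ᶠ δ : ℝ in 𝓝[>] 0, δ ∈ Set.Ioo 0 θ₀ := Ioo_mem_nhdsGT hθ₀
  filter_upwards [hpin, hδev, pinned_frame hR hθ₀ hΩ hpin hbd hΛΩ hlim] with δ hpinδ ⟨hδ0, hδθ₀⟩
    ⟨_, _, _, hht⟩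
  set M : ℤ := mf δ with hM
  set k : ℤ := ⌊z.re / δ - M / 2⌋ with hk
  have hre : ((δ : ℂ) * triEmbed ![k, M] - z).re = δ * (k + M / 2) - z.re := by
    rw [Complex.sub_re, re_real_mul, re_triEmbed_vec2]; ring
  have him : ((δ : ℂ) * triEmbed ![k, M] - z).im = δ * (M : ℝ) * (Real.sqrt 3 / 2) - p.im := by
    rw [Complex.sub_im, im_real_mul, im_triEmbed_vec2, hzim]; ring
  have hk1 : (k : ℝ) ≤ z.re / δ - M / 2 := Int.floor_le _
  have hk2 : z.re / δ - M / 2 < k + 1 := Int.lt_floor_add_one _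
  have h1 : |δ * (k + M / 2) - z.re| ≤ δ := by
    rw [abs_le]
    have e1 := mul_le_mul_of_nonneg_left hk1 hδ0.le
    have e2 := mul_lt_mul_of_pos_left hk2 hδ0
    rw [mul_sub, mul_div_cancel₀ _ hδ0.ne'] at e1 e2
    constructor <;> nlinarith
  have hdist : ‖(δ : ℂ) * triEmbed ![k, M] - z‖ < 2 * θ₀ := by
    calc ‖(δ : ℂ) * triEmbed ![k, M] - z‖
        ≤ |((δ : ℂ) * triEmbed ![k, M] - z).re| + |((δ : ℂ) * triEmbed ![k, M] - z).im| :=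
          Complex.norm_le_abs_re_add_abs_im _
      _ < δ + θ₀ := by rw [hre, him]; exact add_lt_add_of_le_of_lt h1 hht
      _ ≤ 2 * θ₀ := by linarith
  refine ⟨![k, M], ⟨upFace k M, (hpinδ _ (Metric.mem_ball.2 ?_)).2 le_rfl, ?_⟩, by linarith⟩
  · rw [dist_eq_norm]
    have h2 := norm_scaled_sub_le hδ0.le (cell_geometry k M).1 hdist.le
    calc ‖(δ : ℂ) * hexCenter (upFace k M) - p‖ ≤ ‖(δ : ℂ) * hexCenter (upFace k M) - z‖ + ‖z - p‖ :=
          norm_sub_le_norm_sub_add_norm_sub _ _ _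
      _ < R := by linarith
  · unfold upFace; rw [mem_hexFaceVertices_zero]; exact Or.inl rfl

/-- **The station near a point of a pinned flat piece.**  In the frame of `flat_link`, suppose
moreover that near every point `z'` of `Ω` the two-sided bound `δ‖H s − H s_b‖ ≤ B‖F(b δ)‖`
holds eventually at all sites within some `η' > 0` of `z'` (the landed `station_bound`), and
`F(b δ) ≠ 0` eventually.  Then near every `z ≠ x` of the flat piece: for ONE `B ≥ 0`, `η > 0`,
eventually, `δ‖H s − H s_b‖ ≤ B‖F(b δ)‖` for every potential `H`, normaliser site `s_b` and
LATTICE site `s` within `η` of `z` (the station at `z + iη/2 ∈ Ω` plus one `pinned_link`).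
[cite: DuminilCopinSmirnov2012, §4 (the map H with dH = F dz)] -/
theorem flat_station {Ω : Set ℂ} {p x : ℂ} {R : ℝ} {Λ : ℝ → Finset HexVertex} {mf : ℝ → ℤ}
    {bf e b : ℝ → Sym2 HexVertex} (hR : 0 < R)
    (hΩ : Ω ∩ Metric.ball p R = {z : ℂ | p.im < z.im} ∩ Metric.ball p R)
    (hpin : ∀ᶠ δ : ℝ in 𝓝[>] 0, ∀ v : HexVertex,
      (δ : ℂ) * hexCenter v ∈ Metric.ball p R → (v ∈ Λ δ ↔ mf δ ≤ v.1 1))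
    (hbd : ∀ᶠ δ : ℝ in 𝓝[>] 0, bf δ ∈ hexDomainBoundary (Λ δ))
    (hΛΩ : ∀ᶠ δ : ℝ in 𝓝[>] 0, ∀ v ∈ Λ δ, (δ : ℂ) * hexCenter v ∈ Ω)
    (hlim : Tendsto (fun δ : ℝ => (δ : ℂ) * hexMidpoint (bf δ)) (𝓝[>] 0) (𝓝 p))
    (hSup : ∀ K : Set ℂ, IsCompact K → K ⊆ {z : ℂ | p.im ≤ z.im} ∩ Metric.ball p R → x ∉ K →
      ∃ C : ℝ, ∀ᶠ δ : ℝ in 𝓝[>] 0, ∀ w ∈ hexDomainMidEdges (Λ δ), (δ : ℂ) * hexMidpoint w ∈ K →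
        ‖hexParafermionicObservable (Λ δ) (e δ) hexCriticalFugacity (5 / 8) w‖ ≤
          C * ‖hexParafermionicObservable (Λ δ) (e δ) hexCriticalFugacity (5 / 8) (b δ)‖)
    (hFb : ∀ᶠ δ : ℝ in 𝓝[>] 0,
      hexParafermionicObservable (Λ δ) (e δ) hexCriticalFugacity (5 / 8) (b δ) ≠ 0)
    (hst : ∀ z' ∈ Ω, ∃ B η : ℝ, 0 ≤ B ∧ 0 < η ∧ ∀ᶠ δ : ℝ in 𝓝[>] 0, ∀ H : Site 2 → ℂ,
      IsPotential (Λ δ) (e δ) H → ∀ ub wb : HexVertex, b δ = s(ub, wb) →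
      ∀ sb : Site 2, sb ∈ hexFaceVertices ub → sb ∈ hexFaceVertices wb →
      ∀ s : Site 2, ‖(δ : ℂ) * triEmbed s - z'‖ ≤ η →
        δ * ‖H s - H sb‖ ≤ B * ‖hexParafermionicObservable (Λ δ) (e δ) hexCriticalFugacity (5 / 8) (b δ)‖)
    {z : ℂ} (hzR : ‖z - p‖ < R) (hzim : z.im = p.im) (hzx : z ≠ x) :
    ∃ B η : ℝ, 0 ≤ B ∧ 0 < η ∧ ∀ᶠ δ : ℝ in 𝓝[>] 0, ∀ H : Site 2 → ℂ, IsPotential (Λ δ) (e δ) H →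
      ∀ ub wb : HexVertex, b δ = s(ub, wb) →
      ∀ sb : Site 2, sb ∈ hexFaceVertices ub → sb ∈ hexFaceVertices wb →
      ∀ s : Site 2, IsLatticeSite (Λ δ) s → ‖(δ : ℂ) * triEmbed s - z‖ ≤ η →
        δ * ‖H s - H sb‖ ≤ B * ‖hexParafermionicObservable (Λ δ) (e δ) hexCriticalFugacity (5 / 8) (b δ)‖ := by
  have hzx' : 0 < ‖z - x‖ := norm_pos_iff.2 (sub_ne_zero.2 hzx)
  set η : ℝ := min (R - ‖z - p‖) ‖z - x‖ / 40 with hηdef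
  have hmin : 0 < min (R - ‖z - p‖) ‖z - x‖ := lt_min (by linarith) hzx'
  have hη : 0 < η := by positivity
  have h40R : ‖z - p‖ + 40 * η ≤ R := by
    have := min_le_left (R - ‖z - p‖) ‖z - x‖; rw [hηdef]; linarith
  have h40x : 40 * η ≤ ‖z - x‖ := by
    have := min_le_right (R - ‖z - p‖) ‖z - x‖; rw [hηdef]; linarith
  -- the compact at `z` and its sup-law constant
  set K₀ : Set ℂ := {w : ℂ | p.im ≤ w.im} ∩ Metric.closedBall z (20 * η) with hK₀
  have hK₀c : IsCompact K₀ :=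
    (isCompact_closedBall z _).inter_left (isClosed_le continuous_const Complex.continuous_im)
  have hK₀sub : K₀ ⊆ {w : ℂ | p.im ≤ w.im} ∩ Metric.ball p R := by
    rintro w ⟨hwim, hwz⟩
    refine ⟨hwim, Metric.mem_ball.2 ?_⟩
    have h1 := Metric.mem_closedBall.1 hwz
    rw [dist_eq_norm] at h1 ⊢
    calc ‖w - p‖ ≤ ‖w - z‖ + ‖z - p‖ := norm_sub_le_norm_sub_add_norm_sub _ _ _
      _ < R := by linarith
  have hxK₀ : x ∉ K₀ := fun hx => by
    have h := Metric.mem_closedBall.1 hx.2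
    rw [dist_comm, dist_eq_norm] at h
    linarith
  obtain ⟨C, hC⟩ := hSup K₀ hK₀c hK₀sub hxK₀
  set C' : ℝ := max C 0 with hC'def
  have hC'0 : 0 ≤ C' := le_max_right _ _
  -- the station above `z`
  set z' : ℂ := z + ((η / 2 : ℝ) : ℂ) * Complex.I with hz'def
  have hz'z : ‖z' - z‖ = η / 2 := by
    rw [hz'def, add_sub_cancel_left, norm_mul, Complex.norm_I, mul_one, Complex.norm_real,
      Real.norm_of_nonneg (by positivity)]
  have hz'im : z'.im = p.im + η / 2 := by rw [hz'def]; simp [hzim]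
  have hz'Ω : z' ∈ Ω := by
    have h1 : z' ∈ {w : ℂ | p.im < w.im} ∩ Metric.ball p R := by
      refine ⟨by show p.im < z'.im; rw [hz'im]; linarith, Metric.mem_ball.2 ?_⟩
      rw [dist_eq_norm]
      calc ‖z' - p‖ ≤ ‖z' - z‖ + ‖z - p‖ := norm_sub_le_norm_sub_add_norm_sub _ _ _
        _ < R := by rw [hz'z]; linarith
    rw [← hΩ] at h1
    exact h1.1
  obtain ⟨B', η', hB', hη', hQ⟩ := hst z' hz'Ω
  refine ⟨18 * C' * η + B', η, by positivity, hη, ?_⟩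
  have hδev : ∀ᶠ δ : ℝ in 𝓝[>] 0, δ ∈ Set.Ioo 0 (min (η / 8) (η' / 2)) :=
    Ioo_mem_nhdsGT (lt_min (by positivity) (by positivity))
  filter_upwards [hpin, hC, hδev, hFb, hQ, pinned_frame hR (by positivity : (0 : ℝ) < η / 8) hΩ hpin
    hbd hΛΩ hlim] with δ hpinδ hCδ ⟨hδ0, hδlt⟩ hFbδ hQδ ⟨_, _, hlow, hht⟩ H hH ub wb hb sb hsbu hsbw s
    hsl hs
  have hδη : δ ≤ η / 8 := hδlt.le.trans (min_le_left _ _)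
  have hδη' : δ ≤ η' / 2 := hδlt.le.trans (min_le_right _ _)
  set M : ℤ := mf δ with hM
  set Fb := hexParafermionicObservable (Λ δ) (e δ) hexCriticalFugacity (5 / 8) (b δ)
  have hzim' : z.im = p.im := hzim
  have hlow' : z.im < δ * ((M : ℝ) * (Real.sqrt 3 / 2) + Real.sqrt 3 / 6) := by rw [hzim']; exact hlow
  have hpin' : ∀ v : HexVertex, (δ : ℂ) * hexCenter v ∈ Metric.ball z (R - ‖z - p‖) →
      (v ∈ Λ δ ↔ M ≤ v.1 1) := by
    intro v hv
    refine hpinδ v (Metric.mem_ball.2 ?_)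
    have h1 := Metric.mem_ball.1 hv
    rw [dist_eq_norm] at h1 ⊢
    calc ‖(δ : ℂ) * hexCenter v - p‖ ≤ ‖(δ : ℂ) * hexCenter v - z‖ + ‖z - p‖ :=
          norm_sub_le_norm_sub_add_norm_sub _ _ _
      _ < R := by linarith
  -- the station site
  obtain ⟨s₀, hs₀⟩ := exists_site_near hδ0 z'
  have hs₀1 : M ≤ s₀ 1 := by
    have him : z'.im - 2 * δ ≤ ((δ : ℂ) * triEmbed s₀).im := by
      have h := Complex.abs_im_le_norm ((δ : ℂ) * triEmbed s₀ - z')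
      rw [Complex.sub_im] at h
      have := (abs_le.1 (h.trans hs₀)).1
      linarith
    have hsv : s₀ = ![s₀ 0, s₀ 1] := by ext i; fin_cases i <;> simp
    rw [im_real_mul, hsv, im_triEmbed_vec2, hz'im] at him
    have hlt : δ * ((M : ℝ) * (Real.sqrt 3 / 2)) < δ * ((s₀ 1 : ℝ) * (Real.sqrt 3 / 2)) := by
      have := (abs_lt.1 hht).2; nlinarith
    have h3 : (0 : ℝ) < Real.sqrt 3 / 2 := by positivity
    have := lt_of_mul_lt_mul_left hlt hδ0.le
    have : (M : ℝ) < s₀ 1 := lt_of_mul_lt_mul_right this h3.le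
    exact_mod_cast this.le
  have hs₀z : ‖(δ : ℂ) * triEmbed s₀ - z‖ ≤ η := by
    calc ‖(δ : ℂ) * triEmbed s₀ - z‖ ≤ ‖(δ : ℂ) * triEmbed s₀ - z'‖ + ‖z' - z‖ :=
          norm_sub_le_norm_sub_add_norm_sub _ _ _
      _ ≤ η := by rw [hz'z]; linarith
  have hs1 : M ≤ s 1 := row_le_of_isLatticeSite hδ0.le hpin' hsl (by linarith)
  -- the local link from `s` to the station site
  have hlink := pinned_link (K := K₀) (x := z) (z := z) (r := R - ‖z - p‖) (η := η) (M := M) hδ0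
    (by linarith) hC'0 hpin' hlow'
    (fun w hw => ⟨by rw [← hzim']; exact hw.1, Metric.closedBall_subset_closedBall (by linarith) hw.2⟩)
    (by rw [sub_self, norm_zero]; linarith)
    (fun w hw hwK => (hCδ w hw hwK).trans (mul_le_mul_of_nonneg_right (le_max_left _ _) (norm_nonneg _)))
    hs1 hs₀1 hs hs₀z hH
  have hdist : ‖(δ : ℂ) * triEmbed s₀ - (δ : ℂ) * triEmbed s‖ ≤ 2 * η := by
    calc ‖(δ : ℂ) * triEmbed s₀ - (δ : ℂ) * triEmbed s‖
        = ‖((δ : ℂ) * triEmbed s₀ - z) - ((δ : ℂ) * triEmbed s - z)‖ := by ring_nf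
      _ ≤ ‖(δ : ℂ) * triEmbed s₀ - z‖ + ‖(δ : ℂ) * triEmbed s - z‖ := norm_sub_le _ _
      _ ≤ 2 * η := by linarith
  have h1 : δ * ‖H s₀ - H s‖ ≤ 18 * C' * η * ‖Fb‖ := by
    have h := mul_norm_le_of_norm_div_le hδ0.le hFbδ hlink
    refine h.trans (mul_le_mul_of_nonneg_right ?_ (norm_nonneg _))
    have h6 : 0 ≤ 6 * C' := by positivity
    nlinarith [mul_le_mul_of_nonneg_left (show ‖(δ : ℂ) * triEmbed s₀ - (δ : ℂ) * triEmbed s‖ + δ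
      ≤ 3 * η by linarith) h6]
  have h2 : δ * ‖H s₀ - H sb‖ ≤ B' * ‖Fb‖ := hQδ H hH ub wb hb sb hsbu hsbw s₀ (by linarith)
  calc δ * ‖H s - H sb‖ = δ * ‖(H s - H s₀) + (H s₀ - H sb)‖ := by ring_nf
    _ ≤ δ * (‖H s - H s₀‖ + ‖H s₀ - H sb‖) := mul_le_mul_of_nonneg_left (norm_add_le _ _) hδ0.le
    _ = δ * ‖H s₀ - H s‖ + δ * ‖H s₀ - H sb‖ := by rw [mul_add, norm_sub_rev]
    _ ≤ 18 * C' * η * ‖Fb‖ + B' * ‖Fb‖ := add_le_add h1 h2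
    _ = (18 * C' * η + B') * ‖Fb‖ := by ring

/-- **The two normaliser sites are asymptotically identified.**  In the frame of the gate
(`bf = b`, the normaliser itself, `p ≠ x`): for every `ε > 0`, eventually as `δ → 0+`, for every
potential `H` and any two normaliser sites `s_b`, `s_b'` (common vertices of the two faces of
`b δ`, in either presentation), `‖δ(H s_b' − H s_b)/F(b δ)‖ ≤ ε` (both are lattice sites within
`δ` of `δ·mid(b δ) → p`, and `flat_link` at `p` applies). [cite: DuminilCopinSmirnov2012, §4 (the map H with dH = F dz)] -/
theorem normaliser_sites_close {Ω : Set ℂ} {p x : ℂ} {R : ℝ} {Λ : ℝ → Finset HexVertex}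
    {mf : ℝ → ℤ} {e b : ℝ → Sym2 HexVertex} (hR : 0 < R)
    (hΩ : Ω ∩ Metric.ball p R = {z : ℂ | p.im < z.im} ∩ Metric.ball p R)
    (hpin : ∀ᶠ δ : ℝ in 𝓝[>] 0, ∀ v : HexVertex,
      (δ : ℂ) * hexCenter v ∈ Metric.ball p R → (v ∈ Λ δ ↔ mf δ ≤ v.1 1))
    (hbd : ∀ᶠ δ : ℝ in 𝓝[>] 0, b δ ∈ hexDomainBoundary (Λ δ))
    (hΛΩ : ∀ᶠ δ : ℝ in 𝓝[>] 0, ∀ v ∈ Λ δ, (δ : ℂ) * hexCenter v ∈ Ω)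
    (hlim : Tendsto (fun δ : ℝ => (δ : ℂ) * hexMidpoint (b δ)) (𝓝[>] 0) (𝓝 p))
    (hSup : ∀ K : Set ℂ, IsCompact K → K ⊆ {z : ℂ | p.im ≤ z.im} ∩ Metric.ball p R → x ∉ K →
      ∃ C : ℝ, ∀ᶠ δ : ℝ in 𝓝[>] 0, ∀ w ∈ hexDomainMidEdges (Λ δ), (δ : ℂ) * hexMidpoint w ∈ K →
        ‖hexParafermionicObservable (Λ δ) (e δ) hexCriticalFugacity (5 / 8) w‖ ≤
          C * ‖hexParafermionicObservable (Λ δ) (e δ) hexCriticalFugacity (5 / 8) (b δ)‖)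
    (hpx : p ≠ x) {ε : ℝ} (hε : 0 < ε) :
    ∀ᶠ δ : ℝ in 𝓝[>] 0, ∀ H : Site 2 → ℂ, IsPotential (Λ δ) (e δ) H →
      ∀ ub wb : HexVertex, b δ = s(ub, wb) →
      ∀ sb : Site 2, sb ∈ hexFaceVertices ub → sb ∈ hexFaceVertices wb →
      ∀ ub' wb' : HexVertex, b δ = s(ub', wb') →
      ∀ sb' : Site 2, sb' ∈ hexFaceVertices ub' → sb' ∈ hexFaceVertices wb' →
        ‖(δ : ℂ) * (H sb' - H sb) / hexParafermionicObservable (Λ δ) (e δ) hexCriticalFugacity (5 / 8) (b δ)‖ ≤ ε := by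
  obtain ⟨η, C, hη, hC, hlink⟩ := flat_link (e := e) (b := b) hR hΩ hpin hbd hΛΩ hlim hSup
    (by rw [sub_self, norm_zero]; exact hR) rfl hpx
  have hframe := pinned_frame hR (half_pos hη) hΩ hpin hbd hΛΩ hlim
  have hδev : ∀ᶠ δ : ℝ in 𝓝[>] 0, δ ∈ Set.Ioo 0 (min (η / 2) (ε / (3 * C + 1))) :=
    Ioo_mem_nhdsGT (lt_min (half_pos hη) (by positivity))
  filter_upwards [hlink, hbd, hframe, hδev] with δ hlinkδ hbdy ⟨⟨k, hk⟩, hnear, _, _⟩ ⟨hδ0, hδlt⟩ H hH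
    ub wb hb sb hsbu hsbw ub' wb' hb' sb' hsbu' hsbw'
  have hδη : δ ≤ η / 2 := hδlt.le.trans (min_le_left _ _)
  have hδε : δ ≤ ε / (3 * C + 1) := hδlt.le.trans (min_le_right _ _)
  -- both normaliser sites are lattice sites within `η` of `p`
  have hsite : ∀ (u w : HexVertex) (t : Site 2), b δ = s(u, w) → t ∈ hexFaceVertices u →
      t ∈ hexFaceVertices w → IsLatticeSite (Λ δ) t ∧ ‖(δ : ℂ) * triEmbed t - p‖ ≤ η ∧
        ‖(δ : ℂ) * triEmbed t - (δ : ℂ) * hexMidpoint (b δ)‖ ≤ δ := by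
    intro u w t hbt htu htw
    obtain ⟨ht1, -⟩ := floorSites_near_midpoint _ _ _ _ (hk.symm.trans hbt) _ htu htw
    rw [← hk] at ht1
    refine ⟨isLatticeSite_of_mem_boundary hbdy hbt htu htw, ?_, ?_⟩
    · have := norm_scaled_sub_le (A := η / 2) hδ0.le ht1 hnear.le
      linarith
    · rw [norm_smul_sub hδ0.le]
      exact (mul_le_mul_of_nonneg_left ht1 hδ0.le).trans (le_of_eq (mul_one δ))
  obtain ⟨hl, hnp, hmid⟩ := hsite ub wb sb hb hsbu hsbw
  obtain ⟨hl', hnp', hmid'⟩ := hsite ub' wb' sb' hb' hsbu' hsbw'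
  have hdist : ‖(δ : ℂ) * triEmbed sb' - (δ : ℂ) * triEmbed sb‖ ≤ 2 * δ := by
    calc ‖(δ : ℂ) * triEmbed sb' - (δ : ℂ) * triEmbed sb‖
        = ‖((δ : ℂ) * triEmbed sb' - (δ : ℂ) * hexMidpoint (b δ)) -
            ((δ : ℂ) * triEmbed sb - (δ : ℂ) * hexMidpoint (b δ))‖ := by ring_nf
      _ ≤ ‖(δ : ℂ) * triEmbed sb' - (δ : ℂ) * hexMidpoint (b δ)‖ +
            ‖(δ : ℂ) * triEmbed sb - (δ : ℂ) * hexMidpoint (b δ)‖ := norm_sub_le _ _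
      _ ≤ 2 * δ := by linarith
  have h1 := hlinkδ H hH sb sb' hl hl' hnp hnp'
  have h3C : 0 ≤ 3 * C := by positivity
  have hCε : (3 * C) * (ε / (3 * C + 1)) ≤ ε := by
    rw [mul_div_assoc', div_le_iff₀ (by positivity)]
    nlinarith
  calc ‖(δ : ℂ) * (H sb' - H sb) / hexParafermionicObservable (Λ δ) (e δ) hexCriticalFugacity (5 / 8) (b δ)‖
      ≤ C * (‖(δ : ℂ) * triEmbed sb' - (δ : ℂ) * triEmbed sb‖ + δ) := h1
    _ ≤ C * (3 * δ) := mul_le_mul_of_nonneg_left (by linarith) hC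
    _ = (3 * C) * δ := by ring
    _ ≤ (3 * C) * (ε / (3 * C + 1)) := mul_le_mul_of_nonneg_left hδε h3C
    _ ≤ ε := hCε

/-- **Registered piece `developingMapsCompact_latticeRows`** of stub `stub_developingMapsCompact`
(crux stmt-CriticalPhenomena-14004, line `pick-half-plane`): lattice sites over a pinned flat piece
lie in rows `≥` the threshold row, in registry form (one `∀`-term; see `row_le_of_isLatticeSite`).
[folklore] -/
theorem developingMapsCompact_latticeRows : ∀ (Λ : Finset HexVertex) (M : ℤ) (p : ℂ) (R δ : ℝ) (s : Site 2), 0 ≤ δ → (∀ v : HexVertex, (δ : ℂ) * hexCenter v ∈ Metric.ball p R → (v ∈ Λ ↔ M ≤ v.1 1)) → IsLatticeSite Λ s → ‖(δ : ℂ) * triEmbed s - p‖ + δ < R → M ≤ s 1 :=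
  fun _ _ _ _ _ _ hδ hpin hs hsR => row_le_of_isLatticeSite hδ hpin hs hsR

end Summit.CriticalPhenomena.SAWScalingLimit.Theorems.PickHalfPlane.DevelopingMaps

end
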